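import Summits.QuantumFields.YangMills.Theorems.BalabanUVNodesN12AtRecord13Prop1KnitThm1OfRecord
import Literature.MathematicalPhysics.QuantumFieldTheory.Balaban1983to89.B15Prop1EndpointFromLetterFamilies

/-!
# BalabanUVNodes ∕ N12 — N12's PROPOSITION-1 ROW AT THE RECORD RE-KEYED ON THE w-WAVE's JUNCTION ENDPOINT OF LETTER FAMILIES (dag-n12-w5 g4, `B15Prop1EndpointFromLetterFamilies`
# `…_ofThm1TorusClass_ofMinimiserFamily_ofGaugeChartLetters_ofCoercive`, p628231; dag-n12-c g18's coercive road J-C-coer p623795 + dag-n12-w5's package-from-letters p625120 inside):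
# 12Q⁸ (`…Prop1KnitThm1NearFlatLocOfRecord`, p619996) with (J0′) in the R-EXPLICIT shape `hMin` (the radius `R P i` an INPUT letter, no `∃ R`), the near-flat package (N) REPLACED by the
# gauge-letter family (σ) `hσ` and the chart-letter family (χ) `hχ` (+ `δin`), the region parallelepipeds `LO HI n' ρn` of the normalisation, the bookkeeping letter `hcJ'`, `[Finite ι]`
# gone — §1 generic `Θ` (raw rows at `λ`'s other letters); §2 «12X-W v2» = THIS Prop-1 row knitted into 12Zᴳ-W §2 (p623526): the WINDOW-GUARDED N12 socket of the K1 closers of record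
# at a door below e⁻³ with EVERY layer letter an object of record (Track A, DAG node N12 = [B15, Balaban1989LargeFieldI] CMP **122** (1989) 175–202; cluster K1 — K1⁹
# `StabilityBRunRowsAtRecordR13SepCoPHV` = stmt-QuantumFields-27364 (the N12 binder text is edition-free), helper; seat `pub-ymgap-dag-n12-d` g17 (R134 s2 «knit at the record»),
# 2026-08-28; count-neutral, CONDITIONAL, NOT a discharge)

HONEST FRAMING.  Count-neutral kernel COMPOSITION BY NAME: dag-n12-w5's junction endpoint run by run (`choose areg`) ∘ 12E's leaf knit (§1) ∕ 12Zᴳ-W §2 (§2).  Per run `P` and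
Prop-1 instance `i : ι P` the displayed letters are EXACTLY the endpoint's, indexed by the run (lattice `F.P P.K`, numerics `Θ.ν` ∕ `θW.ν`): structure + box data, the region boxes
`LO HI n' ρn` (`hLO hHI hn' hn'N hR' hρn`), (J0′) R-explicit `hMin` with `hR`, the gauge family (σ) `hσ`, the chart family (χ) `hχ`, the constants `δc δin μc ρc δ₂c Kc τc` with
`hsm`∕`hγle`, the geometry `hZ1` (⟹ `hfar` by dag-n12-c's `far_letter_of_box`) ∕ (Gᵃ) `hZblk` ∕ `hdiv`, bookkeeping `cE cA` with `heRa`∕`hcA`∕`hcJ'`, and the [15] letter as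
`VariationalThm1RegSepCoP7M F 2 B₃ a₀ a₁'` (⟹ the endpoint's `h15T` by 12Q⁵ §0 `thm1TorusClass_of_variationalThm1RegSepCoP7M`); §1 keeps `hM2`∕`ha₀`, §2 discharges them at the
door-cured witness (`M₁ = L^j ≥ 2` from `1 ≤ j`, `εreg = a₀` by `rfl`) and reads the door's `h15`.  The INHABITATION MAP of these letters (which lineage produces which) is in the
endpoint's module docstring (dag-n12-w5 p628231) — nothing here restates it.  WHICH CHILD BLOCKS: live-mass (NODE 00); the endpoint's displayed letters (the w-lineage: (J0′) dag-n12-w1,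
(σ) dag-n12-w6 ∕ w2 ∕ w3, (χ) dag-n12-w4 ∕ dag-n10-w1, numerics ∕ geometry dag-n12-c); in §1 the raw (1.80)∕(1.89) at `λ.D189 P` and the (1.100) pin; in §2 the located per-run rows of
12Zᴳ-W §2 (levels, situation numbers, `hC`∕`hMl`, `hβhist`, `Λ ≠ ∅`, four ℍ-leaves + (1.80)).  Nothing of Bałaban's is asserted; every printed fact is a hypothesis; N12 is NOT discharged;
no node is discharged; K0⁷ ∕ K1⁹ NOT closed; counts unmoved (discharged 5∕27 · Track A 5∕28).  ONE finite four-torus programme at fixed `ε = L^{-K}` — nothing continuum ∕ ℝ⁴ ∕ OS ∕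
mass gap ∕ Clay.  No `sorry`, `def`, `instance`, `notation`.

Sources: [Balaban1989LargeFieldI] (0.1)–(0.6) pp.175–176, (1.2) p.178, (1.74) p.192, p.193 ll.14–20, Prop. 1 (1.77)–(1.78) p.194, (1.79)–(1.80) p.195, (1.89) p.198, (1.91)–(1.97)
pp.198–199, (1.99)–(1.102) pp.200–201; [Balaban1989LargeFieldII] p.357, (1.7)–(1.13) pp.358–359, (17)–(19) pp.360–361; [Balaban1985Variational] (3)–(4) p.278, Thm 1 (8) p.279,
(16)–(18) p.280, Prop. 9 (190) p.309; [Balaban1988Convergent] (2.1)–(2.9) pp.254–256, (2.12)–(2.14) pp.256–257, (2.17)–(2.18) p.257, (3.16)–(3.25) pp.268–270; [Balaban1987RG1] Thm 1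
p.259, (0.20) p.256.
-/

noncomputable section
open MeasureTheory Set Finset Metric Filter
open scoped Matrix.Norms.L2Operator BigOperators Matrix RealInnerProductSpace Real InnerProductSpace Topology

namespace Summit.QuantumFields.YangMills.BalabanUVNodes.N12AtRecord13Prop1KnitThm1LetterFamiliesOfRecord

open Literature.MathematicalPhysics.QuantumFieldTheory.Balaban1983to89
open Literature.MathematicalPhysics.QuantumFieldTheory.Balaban1983to89.T4Continuum (T4Family)
open Literature.MathematicalPhysics.QuantumFieldTheory.Balaban1983to89.DagBinding
open Literature.MathematicalPhysics.QuantumFieldTheory.Balaban1983to89.Node00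
open FlowStep (prefixOf BetaLowerH BetaUpperH)
open B15Claim189Assembly (Setting189 new189 chiPP dom half)
open B15 (Prop1Printed Ineq180)
open B15.BasicStep (Claim189)
open B15.PrelimIntegrations (Ineq191 Ineq195)
open B15Chi124DetSets (E124)
open B14DomainGeom (Pt)
open B8Eq17ClassAkV1 (plaqsOf)
open B14.Eq216Concrete (inputs)
open GaugeGroup (dist1)
open GaugeField (plaqHol gaugeAct)
open B15Claim189PrintedConditions (omegaOfChain)
open B15Claim189PinsOfHistory (N0OfRecord₁₃)
open B15Claim189LambdaPin (enlD)
open B15RPrime1100OfRep (rPrimeDataOfSel)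
open Summit.QuantumFields.YangMills.BalabanUVNodes.N12AtRecord13OfResiduals (b15Leaf_WOfRecord₁₃_liveRepin₁₃_of_massLive_of_hasResiduals)
open Summit.QuantumFields.YangMills.BalabanUVNodes.N12AtRecord13Prop1KnitThm1OfRecord (thm1TorusClass_of_variationalThm1RegSepCoP7M)
open T4CubeChartGnomonic (SU2)
open B15Prop1ChartSU2 (su2Chart)
open B15Prop1SliceCoordinates (GaugeSlice ιA)
open T4AxialGaugeSmallField (castSite boxPlaqs boxBonds)
open B6BondElimination (unitVec)
open B6TreeGaugePoincare (curl)
open B16Eq18Proof (box)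
open B15Extension193 (extend)
open B15ShellGauge193 (shellGauge)
open B15Sect1Instances (fun177std)
open B14.Eq213DetSet (Bj maxDomT)
open B14.Eq213MaximalDomains (side)
open B14.Eq22Determines (blockIter IsBlockUnion)
open Literature.MathematicalPhysics.QuantumFieldTheory.BalabanImbrieJaffe1984to88.BIJ85Eq453GaugeField (qsstarGIter0)
open B16Sect1Backgrounds (expMul toMS)
open B15DeterminingSets (pts DetBackground genSet IsMinimizer MSField avgFamily bondsOf)
open B15Prop1Carrier (lfVarOn InstOn InstOn.std plaqsInside)
open B15Prop1EndpointFromLetterFamilies (exists_domain_prop1Printed_lfVarOn_std_su2_box_intrinsic_analytic_atZSeqCoPRecord_ofThm1TorusClass_ofMinimiserFamily_ofGaugeChartLetters_ofCoercive)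
open T4AdjointCovarianceUnitary (lieSU)
open B15Prop1GradientFromNearValueAtCoPRecord (far_letter_of_box)
open B15Prop1AnalyticExtClause (cplxVec anExt)
open B15Prop1ChartCalculusSU2 (E3)

variable {F : T4Family}

/-! ## §1 `N = 2`, generic `Θ` carrying node00-def-K0b's residuals: 12Q⁸ §1 re-keyed on the junction endpoint of letter families -/

section Generic
variable (Θ : Stage13Params F 2) (lam : ResidW F 2)

/-- **★★★★ N12's ROW BELOW THE TORUS AT THE LIVE RE-PIN, `N = 2`, AT PRINT's (1.74) OBJECT, PROP. 1 FROM THE JUNCTION ENDPOINT OF LETTER FAMILIES** — 12Q⁸ §1 with dag-n12-c's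
localised near-flat endpoint replaced by dag-n12-w5's `…_ofMinimiserFamily_ofGaugeChartLetters_ofCoercive`, run by run: per run `P` and instance `i : ι P` the configuration letter is
(J0′) R-EXPLICIT `hMin` (radius `R P i`, bound `𝓐₀ P i` — INPUTS), the analytic letters are the gauge family (σ) `hσ` and the chart family (χ) `hχ` at the guarded base fields with
normalised extended datum on the region box `LO HI` (tolerance `ρn`), the numerics `hsm`∕`hγle`∕`hcJ'`; the conclusion PRODUCES only the thresholds `areg P i`; [15] input =
`VariationalThm1RegSepCoP7M F 2 B₃ a₀ a₁'` via 12Q⁵ §0's junction; `hfar` from `hZ1` by `far_letter_of_box`; then 12E's `b15Leaf_WOfRecord₁₃_liveRepin₁₃_of_massLive_of_hasResiduals`.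
WHAT STAYS A LETTER: everything displayed (see the endpoint's inhabitation map); K0b's residuals `hres`; N12's per-run displays below the torus ((1.100) pin, live-mass, (1.80), (1.89)).
Count-neutral; NOT a discharge of N12. [cite: Balaban1989LargeFieldI, (0.2)–(0.6) p.176, (1.74) p.192, p.193 ll.14–20, Prop. 1 (1.77)–(1.78) p.194, (1.79)–(1.80) p.195, (1.89) p.198, (1.99)–(1.102) pp.200–201; Balaban1989LargeFieldII, p.357, (1.7)–(1.13) pp.358–359, (17)–(19) pp.360–361; Balaban1988Convergent, (2.1) p.254, (2.12)–(2.14) pp.256–257, (2.18) p.257, (3.16) p.268, (3.22)–(3.25) pp.269–270; Balaban1985Variational, (3)–(4) p.278, Thm 1 (8) p.279, (16)–(18) p.280, Prop. 9 (190) p.309 (bookkeeping)] -/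
theorem exists_areg_pinLF_b15Leaf_WOfRecord₁₃_liveRepin₁₃_of_massLive_of_hasResiduals_of_variationalThm1RegSepCoP7M_atZSeqCoPRecord_letterFamilies (hres : Θ.HasResidualsOfRecord F 2)
    -- N12's displays at the letters `kSel ∕ D189 ∕ D1100` of `λ`, run by run, BELOW THE TORUS
    (hpin : ∀ P : B12.RunParams, lam.kSel P < P.K → lam.D1100 P
      = rPrimeDataOfSel (reprTOfRecord₁₃ F 2 (Θ.liveRepin₁₃ F 2) P (lam.kSel P))
          ((Θ.liveRepin₁₃ F 2).ppSel P (gOfRecord₁₃ F 2 (Θ.liveRepin₁₃ F 2) P) (lam.kSel P + 1))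
          (fibOfSeq F (Θ.liveRepin₁₃ F 2).ν (Θ.liveRepin₁₃ F 2).τ9 P (gOfRecord₁₃ F 2 (Θ.liveRepin₁₃ F 2) P) (lam.kSel P + 1)))
    (hmassLive : ∀ P : B12.RunParams, lam.kSel P < P.K → ∀ s, LiveSeq F 2 Θ.ν Θ.τ9 P (gOfRecord₁₃ F 2 (Θ.liveRepin₁₃ F 2) P) (lam.kSel P + 1)
        (slotsTOfRecord F 2 Θ.ν Θ.τ9 (EOfRecord₁₃ F 2 (Θ.liveRepin₁₃ F 2)) (wOfRecord₉ F 2 (Θ.liveRepin₁₃ F 2).toStage9Params)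
          (Θ.liveRepin₁₃ F 2).ppSel P (gOfRecord₁₃ F 2 (Θ.liveRepin₁₃ F 2) P) (lam.kSel P + 1)) s →
      0 < ∫ V, rterm (reprTOfRecord₁₃ F 2 (Θ.liveRepin₁₃ F 2) P (lam.kSel P)) s V ∂(fieldMeasure (F.P P.K) (lam.kSel P + 1) (SU 2)))
    (h180 : ∀ P : B12.RunParams, lam.kSel P < P.K → ∀ U, new189 (lam.D189 P) U → ∀ i, (lam.D189 P).h ≤ i → i ≤ (lam.D189 P).k →
      ∀ q ∈ plaqsOf (dom (lam.D189 P) i),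
        Ineq180 ((lam.D189 P).dev0 U q) ((lam.D189 P).ε (lam.D189 P).k) (lam.D189 P).η (lam.D189 P).B₃ (lam.D189 P).B₅ (lam.D189 P).M (lam.D189 P).δ
          ((lam.D189 P).dist q) (lam.D189 P).O1)
    (h189 : ∀ P : B12.RunParams, lam.kSel P < P.K → Claim189 (new189 (lam.D189 P)) (chiPP (lam.D189 P)))
    -- dag-n12-w5's junction endpoint's letters ON THE RUN's LATTICE `F.P P.K`, per run `P` and instance `i : ι P` (structure ∕ region boxes ∕ (J0′) R-explicit ∕ (σ) ∕ (χ) ∕ numerics, verbatim)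
    (hd3 : ∀ P : B12.RunParams, 3 ≤ (F.P P.K).d) (h0 : ∀ P : B12.RunParams, 0 < (F.P P.K).d) (ι : B12.RunParams → Type)
    {B₃ a₀ a₁' : ℝ}
    (Z Λ : ∀ P : B12.RunParams, ι P → Set (Site (F.P P.K) 0)) (k : ∀ P : B12.RunParams, ι P → ℕ) (M : ∀ P : B12.RunParams, ι P → ℝ) (hk0 : ∀ P i, 0 < k P i) (hk : ∀ P i, k P i ≤ (F.P P.K).m + (F.P P.K).K)
    (eR : ∀ P : B12.RunParams, ι P → ℝ) (heR : ∀ P i, 0 < eR P i)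
    (T : ∀ (P : B12.RunParams) (i : ι P), Finset (PBond (F.P P.K) (k P i)))
    (lo hi : ∀ P : B12.RunParams, ι P → Fin (F.P P.K).d → ℤ) (n : ∀ P : B12.RunParams, ι P → ℕ) (hn : ∀ P i κ, hi P i κ ≤ lo P i κ + n P i) (hN : ∀ P i, n P i + 2 < (F.P P.K).sitesPerDir (k P i))
    (hbox : ∀ P i, pts (k P i) (Λ P i) = (castSite '' Set.Icc (lo P i) (hi P i) : Set (Site (F.P P.K) (k P i))))
    (hZ : ∀ P i, (boxPlaqs (lo P i - 1) (hi P i + 1) : Set (Plaq (F.P P.K) (k P i))) ⊆ plaqsInside (pts (k P i) (Z P i)))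
    (hTG0 : ∀ P i, T P i = (box (fun κ => (hi P i κ - lo P i κ + 1).toNat) (lo P i)).image fun x =>
      (⟨castSite (x - unitVec ⟨0, h0 P⟩), ⟨0, h0 P⟩⟩ : PBond (F.P P.K) (k P i)))
    (hN5 : ∀ P i κ, ((hi P i κ - lo P i κ + 1).toNat : ℤ) + 5 < (F.P P.K).sitesPerDir (k P i))
    (Kb : ∀ P : B12.RunParams, ι P → ℕ) (hK1 : ∀ P i, 1 ≤ Kb P i) (hKn : ∀ P i κ, (hi P i κ - lo P i κ + 1).toNat ≤ Kb P i)
    (ext : ∀ (P : B12.RunParams) (i : ι P), GaugeField (F.P P.K) (k P i) SU2 → GaugeField (F.P P.K) (k P i) SU2)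
    (hext : ∀ P i Vk, ext P i Vk = extend (pts (k P i) (Λ P i)) (shellGauge Vk (lo P i) (hi P i)) Vk)
    (hlohi : ∀ P i, lo P i ≤ hi P i)
    -- the REGION parallelepipeds of the normalisation and the datum tolerances
    (LO HI : ∀ P : B12.RunParams, ι P → Fin (F.P P.K).d → ℤ) (hLO : ∀ P i, LO P i ≤ lo P i - 1) (hHI : ∀ P i, hi P i + 1 ≤ HI P i) (n' : ∀ P : B12.RunParams, ι P → ℕ) (hn' : ∀ P i κ, HI P i κ ≤ LO P i κ + n' P i)
    (hn'N : ∀ P i, n' P i < (F.P P.K).sitesPerDir (k P i)) (hR' : ∀ P i, (boxPlaqs (LO P i) (HI P i) : Set (Plaq (F.P P.K) (k P i))) ⊆ plaqsInside (pts (k P i) (Z P i)))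
    (ρn : ∀ P : B12.RunParams, ι P → ℝ)
    (hρn : ∀ P i, (((F.P P.K).d : ℝ) * n' P i + 1) * ((((F.P P.K).d - 1 : ℕ) : ℝ) * n' P i * ((12 * (F.P P.K).d * (n P i + 2) ^ 2 + 1) * eR P i)
      + 3 * (F.P P.K).d * (n P i + 2) ^ 2 * eR P i) ≤ ρn P i)
    {γ₈ cJ bx : B12.RunParams → ℝ} (hγ : ∀ P, 0 < γ₈ P) (hcJ : ∀ P, 0 ≤ cJ P) (hbx : ∀ P, 0 ≤ bx P)
    (hbxM : ∀ P i, 12 * ((F.P P.K).d : ℝ) * ((n P i : ℝ) + 2) ^ 2 ≤ bx P * (M P i) ^ 2)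
    {R 𝓐₀ : ∀ P : B12.RunParams, ι P → ℝ} (hM : ∀ P i, 1 ≤ (M P i)) (hR : ∀ P i, 0 < R P i)
    -- (J0′), R-EXPLICIT: per instance one radius and one bound for every base field of the strict guard
    (hMin : ∀ P i Vk, PlaqSmallOn (plaqsInside (pts (k P i) (Z P i ∩ (Λ P i)ᶜ))) (eR P i) Vk →
      ∃ Ũ : VecField (F.P P.K) (k P i) (EuclideanSpace ℂ (Fin 3)) × VecField (F.P P.K) (k P i) (EuclideanSpace ℂ (Fin 3)) →
          PBond (F.P P.K) 0 → Matrix (Fin 2) (Fin 2) ℂ,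
        (∀ b a c, DifferentiableOn ℂ (fun z => Ũ z b a c) (ball 0 (R P i))) ∧
        (∀ z ∈ ball (0 : VecField (F.P P.K) (k P i) (EuclideanSpace ℂ (Fin 3)) × VecField (F.P P.K) (k P i) (EuclideanSpace ℂ (Fin 3))) (R P i),
          ∀ b a c, ‖Ũ z b a c‖ ≤ 𝓐₀ P i) ∧
        ∀ p B' : VecField (F.P P.K) (k P i) E3, ‖p‖ < R P i → ‖B'‖ < R P i → ∃ U' : GaugeField (F.P P.K) 0 SU2,
          (∀ b, Ũ (cplxVec p, cplxVec B') b = ((U' b : SU2) : Matrix (Fin 2) (Fin 2) ℂ)) ∧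
            IsMinimizer (Node00.avOfRecord F 2 P.K) (Node00.regMSCoPOfRecord F 2 Θ.ν P.K (k P i) (maxDomT Θ.ν.M₁ (Z P i))) (Bj Θ.ν.M₁ (Z P i) (k P i))
              (avgFamily (Node00.avOfRecord F 2 P.K) (qsstarGIter0 (k P i) (expMul su2Chart B' (ext P i (expMul su2Chart p Vk))))) U')
    {γ₀ : B12.RunParams → ℝ} (hγ₀0 : ∀ P, 0 ≤ γ₀ P)
    {δc δin μc ρc δ₂c Kc τc : ∀ P : B12.RunParams, ι P → ℝ} (hδc0 : ∀ P i, 0 ≤ δc P i) (hμc0 : ∀ P i, 0 ≤ μc P i) (hρc0 : ∀ P i, 0 ≤ ρc P i) (hδ₂c0 : ∀ P i, 0 ≤ δ₂c P i)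
    -- (σ) THE GAUGE LETTER per instance, at the guarded base fields with normalised extended datum
    (hσ : ∀ P i (Vk : GaugeField (F.P P.K) (k P i) SU2), PlaqSmallOn (plaqsInside (pts (k P i) (Z P i ∩ (Λ P i)ᶜ))) (eR P i) Vk →
      (∀ b ∈ (boxBonds (LO P i) (HI P i) : Set (PBond (F.P P.K) (k P i))), dist1 (ext P i Vk b) ≤ ρn P i) →
      ∀ U₀ : GaugeField (F.P P.K) 0 SU2,
        IsMinimizer (Node00.avOfRecord F 2 P.K) (Node00.regMSCoPOfRecord F 2 Θ.ν P.K (k P i) (maxDomT Θ.ν.M₁ (Z P i))) (Bj Θ.ν.M₁ (Z P i) (k P i))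
          (avgFamily (Node00.avOfRecord F 2 P.K) (qsstarGIter0 (k P i) (ext P i Vk))) U₀ →
        ∃ σ : GaugeTransf (F.P P.K) 0 SU2,
          (∀ l, l ≤ k P i → ∀ b ∈ bondsOf (Bj Θ.ν.M₁ (Z P i) (k P i) l), toMS σ l b.src = 1 ∧ toMS σ l b.tgt = 1) ∧
            (∀ p : Plaq (F.P P.K) 0, ((⟨p.src, p.μ⟩ : PBond (F.P P.K) 0) ∈ {b : PBond (F.P P.K) 0 | b.src ∈ maxDomT Θ.ν.M₁ (Z P i) 1} ∨
                (⟨p.src.shift p.μ, p.ν⟩ : PBond (F.P P.K) 0) ∈ {b : PBond (F.P P.K) 0 | b.src ∈ maxDomT Θ.ν.M₁ (Z P i) 1} ∨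
                (⟨p.src.shift p.ν, p.μ⟩ : PBond (F.P P.K) 0) ∈ {b : PBond (F.P P.K) 0 | b.src ∈ maxDomT Θ.ν.M₁ (Z P i) 1} ∨
                (⟨p.src, p.ν⟩ : PBond (F.P P.K) 0) ∈ {b : PBond (F.P P.K) 0 | b.src ∈ maxDomT Θ.ν.M₁ (Z P i) 1}) →
              ‖((gaugeAct σ U₀ ⟨p.src, p.μ⟩ : SU2) : Matrix (Fin 2) (Fin 2) ℂ) - 1‖ ≤ δc P i ∧ ‖((gaugeAct σ U₀ ⟨p.src.shift p.μ, p.ν⟩ : SU2) : Matrix (Fin 2) (Fin 2) ℂ) - 1‖ ≤ δc P i ∧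
                ‖((gaugeAct σ U₀ ⟨p.src.shift p.ν, p.μ⟩ : SU2) : Matrix (Fin 2) (Fin 2) ℂ) - 1‖ ≤ δc P i ∧ ‖((gaugeAct σ U₀ ⟨p.src, p.ν⟩ : SU2) : Matrix (Fin 2) (Fin 2) ℂ) - 1‖ ≤ δc P i) ∧
          (∀ b ∈ inputs (Bj Θ.ν.M₁ (Z P i) (k P i)), ‖((gaugeAct σ U₀ b : SU2) : Matrix (Fin 2) (Fin 2) ℂ) - 1‖ ≤ δin P i))
    -- (χ) THE CHART LETTER per instance
    (hχ : ∀ P i (Vk : GaugeField (F.P P.K) (k P i) SU2), PlaqSmallOn (plaqsInside (pts (k P i) (Z P i ∩ (Λ P i)ᶜ))) (eR P i) Vk →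
      (∀ b ∈ (boxBonds (LO P i) (HI P i) : Set (PBond (F.P P.K) (k P i))), dist1 (ext P i Vk b) ≤ ρn P i) →
      ∀ (U₀ : GaugeField (F.P P.K) 0 SU2) (Xf : GaugeSlice (pts (k P i) (Λ P i)) (T P i) E3 → PBond (F.P P.K) 0 → lieSU (Fin 2)),
        IsMinimizer (Node00.avOfRecord F 2 P.K) (Node00.regMSCoPOfRecord F 2 Θ.ν P.K (k P i) (maxDomT Θ.ν.M₁ (Z P i))) (Bj Θ.ν.M₁ (Z P i) (k P i))
          (avgFamily (Node00.avOfRecord F 2 P.K) (qsstarGIter0 (k P i) (ext P i Vk))) U₀ →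
          (∀ p : Plaq (F.P P.K) 0, ((⟨p.src, p.μ⟩ : PBond (F.P P.K) 0) ∈ {b : PBond (F.P P.K) 0 | b.src ∈ maxDomT Θ.ν.M₁ (Z P i) 1} ∨
              (⟨p.src.shift p.μ, p.ν⟩ : PBond (F.P P.K) 0) ∈ {b : PBond (F.P P.K) 0 | b.src ∈ maxDomT Θ.ν.M₁ (Z P i) 1} ∨
              (⟨p.src.shift p.ν, p.μ⟩ : PBond (F.P P.K) 0) ∈ {b : PBond (F.P P.K) 0 | b.src ∈ maxDomT Θ.ν.M₁ (Z P i) 1} ∨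
              (⟨p.src, p.ν⟩ : PBond (F.P P.K) 0) ∈ {b : PBond (F.P P.K) 0 | b.src ∈ maxDomT Θ.ν.M₁ (Z P i) 1}) →
            ‖((U₀ ⟨p.src, p.μ⟩ : SU2) : Matrix (Fin 2) (Fin 2) ℂ) - 1‖ ≤ δc P i ∧ ‖((U₀ ⟨p.src.shift p.μ, p.ν⟩ : SU2) : Matrix (Fin 2) (Fin 2) ℂ) - 1‖ ≤ δc P i ∧
              ‖((U₀ ⟨p.src.shift p.ν, p.μ⟩ : SU2) : Matrix (Fin 2) (Fin 2) ℂ) - 1‖ ≤ δc P i ∧ ‖((U₀ ⟨p.src, p.ν⟩ : SU2) : Matrix (Fin 2) (Fin 2) ℂ) - 1‖ ≤ δc P i) →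
        (∀ b ∈ inputs (Bj Θ.ν.M₁ (Z P i) (k P i)), ‖((U₀ b : SU2) : Matrix (Fin 2) (Fin 2) ℂ) - 1‖ ≤ δin P i) →
        Xf 0 = 0 → ContDiffAt ℝ 2 Xf 0 →
          (∀ᶠ Y in 𝓝 (0 : GaugeSlice (pts (k P i) (Λ P i)) (T P i) E3),
            IsMinimizer (Node00.avOfRecord F 2 P.K) (Node00.regMSCoPOfRecord F 2 Θ.ν P.K (k P i) (maxDomT Θ.ν.M₁ (Z P i))) (Bj Θ.ν.M₁ (Z P i) (k P i))
              (avgFamily (Node00.avOfRecord F 2 P.K) (qsstarGIter0 (k P i) (expMul su2Chart (ιA (pts (k P i) (Λ P i)) (T P i) Y) (ext P i Vk)))) (expChart U₀ (Xf Y))) →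
        (∀ (X : GaugeSlice (pts (k P i) (Λ P i)) (T P i) E3) (b : PBond (F.P P.K) 0),
          ‖((fderiv ℝ Xf 0 X b : lieSU (Fin 2)) : Matrix (Fin 2) (Fin 2) ℂ)‖ ≤ 8 * 𝓐₀ P i / R P i * ‖X‖ ∧ ‖fderiv ℝ Xf 0 X b‖ ≤ 12 * 𝓐₀ P i / R P i * ‖X‖) →
        (∀ (X : GaugeSlice (pts (k P i) (Λ P i)) (T P i) E3) (b : PBond (F.P P.K) 0), b.src ∉ maxDomT Θ.ν.M₁ (Z P i) 1 → fderiv ℝ Xf 0 X b = 0) →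
          ∃ (Ψ₂ : (PBond (F.P P.K) 0 → lieSU (Fin 2)) →L[ℝ] (PBond (F.P P.K) 0 → lieSU (Fin 2)) →L[ℝ] (Fin (constrCard (Bj Θ.ν.M₁ (Z P i) (k P i)) (k P i)) → lieSU (Fin 2)))
            (lam : (Fin (constrCard (Bj Θ.ν.M₁ (Z P i) (k P i)) (k P i)) → lieSU (Fin 2)) →L[ℝ] ℝ)
            (p : Seminorm ℝ (PBond (F.P P.K) 0 → lieSU (Fin 2))) (q : (Fin (constrCard (Bj Θ.ν.M₁ (Z P i) (k P i)) (k P i)) → lieSU (Fin 2)) → ℝ)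
            (Lf : (PBond (F.P P.K) 0 → lieSU (Fin 2)) →L[ℝ] (Fin (constrCard (Bj Θ.ν.M₁ (Z P i) (k P i)) (k P i)) → lieSU (Fin 2)))
            (Rf : (Fin (constrCard (Bj Θ.ν.M₁ (Z P i) (k P i)) (k P i)) → lieSU (Fin 2)) → PBond (F.P P.K) 0 → lieSU (Fin 2)),
            HasFDerivAt (fun Y => fderiv ℝ (msChart F 2 P.K (k P i) (Bj Θ.ν.M₁ (Z P i) (k P i)) (avgFamily (Node00.avOfRecord F 2 P.K) (qsstarGIter0 (k P i) (ext P i Vk))) U₀) Y) Ψ₂ 0 ∧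
            (∀ᶠ Y in 𝓝 (0 : PBond (F.P P.K) 0 → lieSU (Fin 2)),
              DifferentiableAt ℝ (msChart F 2 P.K (k P i) (Bj Θ.ν.M₁ (Z P i) (k P i)) (avgFamily (Node00.avOfRecord F 2 P.K) (qsstarGIter0 (k P i) (ext P i Vk))) U₀) Y) ∧
            fderiv ℝ (fun Y : PBond (F.P P.K) 0 → lieSU (Fin 2) => wilsonAction4 (expChart U₀ Y)) 0 =
              lam.comp (fderiv ℝ (msChart F 2 P.K (k P i) (Bj Θ.ν.M₁ (Z P i) (k P i)) (avgFamily (Node00.avOfRecord F 2 P.K) (qsstarGIter0 (k P i) (ext P i Vk))) U₀) 0) ∧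
            (∀ Y : PBond (F.P P.K) 0 → lieSU (Fin 2), ∑ b, ‖(Y b : Matrix (Fin 2) (Fin 2) ℂ)‖ ^ 2 ≤ p Y ^ 2) ∧
            (∀ v, Lf (Rf v) = v) ∧ (∀ v, p (Rf v) ≤ ρc P i * q v) ∧
            ∀ X : GaugeSlice (pts (k P i) (Λ P i)) (T P i) E3,
              q (fderiv ℝ (msChart F 2 P.K (k P i) (Bj Θ.ν.M₁ (Z P i) (k P i)) (avgFamily (Node00.avOfRecord F 2 P.K) (qsstarGIter0 (k P i) (ext P i Vk))) U₀) 0 (fderiv ℝ Xf 0 X)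
                  - Lf (fderiv ℝ Xf 0 X)) ≤ δ₂c P i * p (fderiv ℝ Xf 0 X) ∧
              lam (Ψ₂ (fderiv ℝ Xf 0 X) (fderiv ℝ Xf 0 X)) ≤ μc P i * p (fderiv ℝ Xf 0 X) ^ 2 ∧
              p (fderiv ℝ Xf 0 X) ≤ Kc P i * ‖X‖ ∧
              ∃ m : ℝ, (∀ w', Lf w' = fderiv ℝ (msChart F 2 P.K (k P i) (Bj Θ.ν.M₁ (Z P i) (k P i)) (avgFamily (Node00.avOfRecord F 2 P.K) (qsstarGIter0 (k P i) (ext P i Vk))) U₀) 0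
                    (fderiv ℝ Xf 0 X) →
                  m ≤ fderiv ℝ (fun Y => fderiv ℝ (fun Y : PBond (F.P P.K) 0 → lieSU (Fin 2) => wilsonAction4 (expChart (1 : GaugeField (F.P P.K) 0 SU2) Y)) Y) 0 w' w') ∧
                γ₀ P * (∑ z ∈ box (fun κ => (hi P i κ - lo P i κ + 1).toNat + 3) (fun κ => lo P i κ - 2), ∑ μ : Fin (F.P P.K).d, ∑ a : Fin 3,
                    curl (fun b => ιA (pts (k P i) (Λ P i)) (T P i) X (⟨castSite b.1, b.2⟩ : PBond (F.P P.K) (k P i)) a) z ⟨0, h0 P⟩ μ ^ 2) - τc P i * ‖X‖ ^ 2 ≤ m)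
    -- numerics: the assembled `Cerr i` (with the twist defect `τc P i`) is small, and the positivity constant fits
    (hsm : ∀ P i, (32 * (((F.P P.K).d : ℝ) - 1) * δc P i + μc P i + 16 * (((F.P P.K).d : ℝ) - 1) * (ρc P i * δ₂c P i) * (2 + ρc P i * δ₂c P i)) * Kc P i ^ 2 + τc P i
      ≤ γ₀ P / (2 * (3 * (Kb P i : ℝ) ^ 2 + 2 * (Kb P i : ℝ) ^ 4)))
    (hγle : ∀ P i, γ₈ P / (M P i) ^ 5 ≤ γ₀ P / (2 * (3 * (Kb P i : ℝ) ^ 2 + 2 * (Kb P i : ℝ) ^ 4)))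
    -- the geometric letter: every fine site whose k-block label lies in the box `[lo − 1, hi + 1]` lies in `Ω₁(Z)` (print: `Λ` deep inside `Z`); dag-n12-c's `far_letter_of_box` turns it into the bond letter `hfar`
    (hZ1 : ∀ P i (y : Site (F.P P.K) 0), B14.Eq22Determines.blockIter (k P i) y ∈ (castSite '' Set.Icc (lo P i - 1) (hi P i + 1) : Set (Site (F.P P.K) (k P i))) → y ∈ maxDomT Θ.ν.M₁ (Z P i) 1)
    (hZblk : ∀ P i, IsBlockUnion (k P i) (Z P i))
    (hdiv : ∀ P i, side (F.P P.K).L Θ.ν.M₁ (k P i) ∣ (F.P P.K).sitesPerDir 0)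
    {cE cA : B12.RunParams → ℝ} (hcE0 : ∀ P, 0 ≤ cE P) (hcE : ∀ P i, 12 * ((F.P P.K).d : ℝ) * ((n P i : ℝ) + 2) ^ 2 ≤ cE P)
    (heRa : ∀ P i, (cE P + 1) * eR P i ≤ a₁' ∧ B₃ * ((cE P + 1) * eR P i) ≤ Θ.ν.εreg)
    (hcA : ∀ P, 1 / 2 * (B₃ * (cE P + 1) * (F.P P.K).eta 1 ^ 2) ^ 2 * (Fintype.card (Plaq (F.P P.K) 0) : ℝ) ≤ cA P)
    (hcJ' : ∀ P i, 2 * cA P * eR P i / R P i + 4 * ((Fintype.card (Plaq (F.P P.K) 0) : ℝ) * (1 + 8 * 𝓐₀ P i ^ 4)) / (R P i * eR P i) ≤ cJ P)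
    (hM2 : 2 ≤ Θ.ν.M₁) (hB₃ : 0 ≤ B₃) (ha₀ : Θ.ν.εreg ≤ a₀) (h15 : VariationalThm1RegSepCoP7M F 2 B₃ a₀ a₁') :
    ∃ areg : ∀ P : B12.RunParams, ι P → ℝ, (∀ P i, 0 < areg P i) ∧
      ∀ P : B12.RunParams, lam.kSel P < P.K →
        B15Leaf (WOfRecord₁₃ F 2 (Θ.liveRepin₁₃ F 2)
          { lam with LF := fun P => lfVarOn su2Chart fun i => InstOn.std (Node00.bgMSCoPOfRecord F 2 Θ.ν P.K (k P i) (maxDomT Θ.ν.M₁ (Z P i))) Θ.ν.M₁ (Z P i) (Λ P i) (k P i) (M P i) (areg P i) (anExt (pts (k P i) (Λ P i)) (T P i) (fun177std (Node00.bgMSCoPOfRecord F 2 Θ.ν P.K (k P i) (maxDomT Θ.ν.M₁ (Z P i))) Θ.ν.M₁ (Z P i) (k P i)) (ext P i) (min (1 / 2) (min (R P i / 8) (γ₈ P / (M P i) ^ 5 * (R P i / 2) ^ 2 / (48 * (4 * ((Fintype.card (Plaq (F.P P.K) 0) : ℝ) * (1 + 8 * 𝓐₀ P i ^ 4)) / R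 P i + 1)))))) } P) := by
  choose areg ha hP using fun P : B12.RunParams =>
    exists_domain_prop1Printed_lfVarOn_std_su2_box_intrinsic_analytic_atZSeqCoPRecord_ofThm1TorusClass_ofMinimiserFamily_ofGaugeChartLetters_ofCoercive (F := F) Θ.ν P.K (hd3 P) (h0 P)
      (Z := Z P) (Λ := Λ P) (k := k P) (M := M P) (hk0 := hk0 P) (hk := hk P) (eR := eR P) (heR := heR P) (T := T P) (lo := lo P) (hi := hi P) (n := n P) (hn := hn P)
      (hN := hN P) (hbox := hbox P) (hZ := hZ P) (hTG0 := hTG0 P) (hN5 := hN5 P) (K := Kb P) (hK1 := hK1 P) (hKn := hKn P) (ext := ext P) (hext := hext P) (hlohi := hlohi P)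
      (LO := LO P) (HI := HI P) (hLO := hLO P) (hHI := hHI P) (n' := n' P) (hn' := hn' P) (hn'N := hn'N P) (hR' := hR' P) (ρn := ρn P) (hρn := hρn P)
      (hγ := hγ P) (hcJ := hcJ P) (hbx := hbx P) (hbxM := hbxM P) (hM := hM P) (hR := hR P) (hMin := hMin P) (hγ₀ := hγ₀0 P) (hδc0 := hδc0 P) (hμc0 := hμc0 P) (hρc0 := hρc0 P) (hδ₂c0 := hδ₂c0 P)
      (hσ := hσ P) (hχ := hχ P) (hsm := hsm P) (hγle := hγle P) (hfar := fun i b hb => far_letter_of_box (hbox P i) (hZ1 P i) b hb) (hZblk := hZblk P) (hM2 := hM2) (hdiv := hdiv P)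
      (hcE0 := hcE0 P) (hcE := hcE P) (hB₃ := hB₃) (heRa := heRa P) (ha₀ := ha₀) (hcA := hcA P)
      (h15T := thm1TorusClass_of_variationalThm1RegSepCoP7M Θ.ν P.K h15) (hcJ' := hcJ' P)
  refine ⟨areg, ha, fun P hkP => ?_⟩
  apply b15Leaf_WOfRecord₁₃_liveRepin₁₃_of_massLive_of_hasResiduals Θ _ hres (P := P)
  · exact hkP
  · exact hpin P hkP
  · exact hmassLive P hkP
  · exact hP P
  · exact h180 P hkP
  · exact h189 P hkP

end Generic

end Summit.QuantumFields.YangMills.BalabanUVNodes.N12AtRecord13Prop1KnitThm1LetterFamiliesOfRecord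

end
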